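import Mathlib
import Summits.Ventures.PercRepro2.SkeletonReduction
import Summits.Ventures.PercRepro2.StarHLeafMulti

/-!
# (HMF), hence (HCOV), at the end of a pendant path of ANY length (blind cell PercRepro2, night-1
g15; NIGHT1-G15.md §3′ — the closure of `PendantPath`)

`IsPendantPath p ends … k vs es`: `a₃ = vs 0 – vs 1 – … – vs k` with nonzero edges
`es i = {vs i, vs (i+1)}`, `a₃` carrying no other nonzero edge, the interior vertices unmarked,
distinct, each carrying no other nonzero edge.  `HubAt p ends … u x`: every nonzero edge at `u` goes
to `x`, to a mark, or to an unmarked leaf (nonzero-degree one).  **`HMF_pendant_path_any`**: if the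
path ends at such a hub `u = vs k`, (HMF) holds, for every weight vector.  Induction on `k`: the
zero-weight edges are re-routed to loops at `a₁` (`Skeleton.HMFc_congr_nz`), the base `k = 1` is the
two-level table `StarH.HMF_leaf_marks_whiskers`, and the step contracts the first interior vertex by
the series contraction `SeriesCollapse.HMF_series_contract`, which shortens the path by one.
-/

open scoped Classical

namespace Summit.Ventures.PercRepro2

open UnionCluster CovForm

namespace StarH

section Defs

variable {V : Type*} {E : Type*} {R : Type*} [Field R]

/-- **A pendant path** `a₃ = vs 0 – vs 1 – … – vs k` of nonzero edges `es i = {vs i, vs (i+1)}`. -/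
structure IsPendantPath (p : E → R) (ends : E → Sym2 V) (o a₁ a₂ a₃ b : V) (k : ℕ) (vs : ℕ → V)
    (es : ℕ → E) : Prop where
  pos : 0 < k
  first : vs 0 = a₃
  edge : ∀ i, i < k → ends (es i) = s(vs i, vs (i + 1))
  nz : ∀ i, i < k → p (es i) ≠ 0
  inj : ∀ i j, i ≤ k → j ≤ k → vs i = vs j → i = j
  leaf : ∀ e, p e ≠ 0 → a₃ ∈ ends e → e = es 0
  deg : ∀ i, 0 < i → i < k → ∀ e, p e ≠ 0 → vs i ∈ ends e → e = es (i - 1) ∨ e = es i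
  unmarked : ∀ i, 0 < i → i < k → vs i ≠ o ∧ vs i ≠ a₁ ∧ vs i ≠ a₂ ∧ vs i ≠ b

/-- **A hub** `u`: every nonzero edge at `u` joins `u` to `x`, to a mark, or to an unmarked leaf. -/
def HubAt (p : E → R) (ends : E → Sym2 V) (o a₁ a₂ a₃ b u x : V) : Prop :=
  ∀ e, p e ≠ 0 → u ∈ ends e → ends e = s(u, x) ∨ ends e = s(u, a₁) ∨ ends e = s(u, a₂) ∨
    ends e = s(u, o) ∨ ends e = s(u, b) ∨
    (∃ y, ends e = s(u, y) ∧ y ≠ u ∧ y ≠ o ∧ y ≠ a₁ ∧ y ≠ a₂ ∧ y ≠ a₃ ∧ y ≠ b ∧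
      ∀ e', p e' ≠ 0 → y ∈ ends e' → e' = e)

end Defs

section Main

variable {V : Type*} {E : Type*} [Fintype E] [DecidableEq E] [Fintype V] [DecidableEq V]
  {R : Type*} [Field R] [LinearOrder R] [IsStrictOrderedRing R]

omit [Fintype E] [DecidableEq E] [Fintype V] [DecidableEq V] [LinearOrder R]
  [IsStrictOrderedRing R] in
/-- The edges of a pendant path are distinct. -/
lemma IsPendantPath.es_inj {p : E → R} {ends : E → Sym2 V} {o a₁ a₂ a₃ b : V} {k : ℕ} {vs : ℕ → V}
    {es : ℕ → E} (h : IsPendantPath p ends o a₁ a₂ a₃ b k vs es) {i j : ℕ} (hi : i < k) (hj : j < k)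
    (he : es i = es j) : i = j := by
  have h1 := h.edge i hi
  have h2 := h.edge j hj
  rw [he, h2, Sym2.eq_iff] at h1
  rcases h1 with ⟨h1, _⟩ | ⟨h1, h2'⟩
  · exact (h.inj j i hj.le hi.le h1).symm
  · have := h.inj j (i + 1) hj.le hi h1
    have := h.inj (j + 1) i hj hi.le h2'
    omega

/-- **(HMF) AT THE END OF A PENDANT PATH OF ANY LENGTH** into a hub `u = vs k`. -/
theorem HMF_pendant_path_any (o a₁ a₂ a₃ b : V) (h3o : a₃ ≠ o) (h31 : a₃ ≠ a₁) (h32 : a₃ ≠ a₂)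
    (h3b : a₃ ≠ b) :
    ∀ (k : ℕ) (p : E → R) (ends : E → Sym2 V) (vs : ℕ → V) (es : ℕ → E), IsProbVec p →
      IsPendantPath p ends o a₁ a₂ a₃ b k vs es →
      vs k ≠ a₁ → vs k ≠ a₂ → vs k ≠ o → vs k ≠ b →
      HubAt p ends o a₁ a₂ a₃ b (vs k) (vs (k - 1)) → HMF p ends o a₁ a₂ a₃ b := by
  intro k
  induction k using Nat.strong_induction_on with
  | _ k ih =>
  intro p ends vs es hp hpath hu1 hu2 huo hub hhub
  -- re-route the zero-weight edges to loops at `a₁`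
  set ends' := Skeleton.reroute p ends a₁ with hends'
  have hagree : ∀ e, p e ≠ 0 → ends e = ends' e :=
    fun e he => (Skeleton.reroute_of_ne p ends a₁ he).symm
  have hnz : ∀ {z : V}, z ≠ a₁ → ∀ e, z ∈ ends' e → p e ≠ 0 :=
    fun hz e he => Skeleton.ne_zero_of_mem_reroute p ends hz he
  have hHMF : HMF p ends o a₁ a₂ a₃ b ↔ HMF p ends' o a₁ a₂ a₃ b := by
    unfold HMF
    rw [Skeleton.HMFc_congr_nz p hagree o a₁ a₂ a₃ b]
  rw [hHMF]
  have hk := hpath.pos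
  have hvs0 := hpath.first
  -- the interior vertices and `a₃` differ from `a₁`
  have hne1 : ∀ i, i < k → vs i ≠ a₁ := by
    intro i hi
    rcases Nat.eq_zero_or_pos i with rfl | hi0
    · rw [hvs0]; exact h31
    · exact (hpath.unmarked i hi0 hi).2.1
  have hedge' : ∀ i, i < k → ends' (es i) = s(vs i, vs (i + 1)) := fun i hi => by
    rw [← hagree _ (hpath.nz i hi)]; exact hpath.edge i hi
  by_cases hk1 : k = 1
  · -- the base: `a₃` pendant at `u = vs 1`
    subst hk1
    refine HMF_leaf_marks_whiskers ends' o a₁ a₂ a₃ b (vs 1) p hp (f := es 0)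
      (by rw [hedge' 0 Nat.one_pos, hvs0]) ?_ ?_ ?_ h3o h31 h32 h3b hu1 hu2 huo hub
    · intro e he
      have hpe : p e ≠ 0 := hnz h31 e he
      rw [← hagree e hpe] at he
      exact hpath.leaf e hpe he
    · intro e he
      have hpe : p e ≠ 0 := hnz hu1 e he
      rw [← hagree e hpe] at he ⊢
      rcases hhub e hpe he with h | h | h | h | h | ⟨y, hey, hyu, hyo, hy1, hy2, hy3, hyb, hyleaf⟩
      · left; rw [h, Nat.sub_self, hvs0]
      · exact Or.inr (Or.inl h)
      · exact Or.inr (Or.inr (Or.inl h))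
      · exact Or.inr (Or.inr (Or.inr (Or.inl h)))
      · exact Or.inr (Or.inr (Or.inr (Or.inr (Or.inl h))))
      · refine Or.inr (Or.inr (Or.inr (Or.inr (Or.inr ⟨y, hey, hyu, hyo, hy1, hy2, hy3, hyb, ?_⟩))))
        intro e' hy'
        have hpe' : p e' ≠ 0 := hnz hy1 e' hy'
        rw [← hagree e' hpe'] at hy'
        exact hyleaf e' hpe' hy'
    · intro h
      exact (hpath.inj 0 1 (by omega) le_rfl (by rw [hvs0, h])) |> fun h0 => by omega
  · -- the step: contract the first interior vertex `vs 1`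
    have hk2 : 2 ≤ k := by omega
    have hv1 : vs 1 ≠ a₃ := fun h => by
      have := hpath.inj 1 0 (by omega) (by omega) (by rw [h, hvs0])
      omega
    have hv12 : vs 1 ≠ vs 2 := fun h => by
      have := hpath.inj 1 2 (by omega) hk2 h
      omega
    have hff : es 0 ≠ es 1 := fun h => by
      have := hpath.es_inj (by omega) (by omega) h
      omega
    have hf : ends' (es 0) = s(vs 1, a₃) := by rw [hedge' 0 (by omega), hvs0, Sym2.eq_swap]
    have hf' : ends' (es 1) = s(vs 1, vs 2) := hedge' 1 (by omega)
    have hdeg1 : ∀ e, vs 1 ∈ ends' e → e = es 0 ∨ e = es 1 := by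
      intro e he
      have hpe : p e ≠ 0 := hnz (hne1 1 (by omega)) e he
      rw [← hagree e hpe] at he
      exact hpath.deg 1 Nat.one_pos (by omega) e hpe he
    obtain ⟨hv1o, hv11, hv12', hv1b⟩ := hpath.unmarked 1 Nat.one_pos (by omega)
    rw [SeriesCollapse.HMF_series_contract p hp hff hf hf' hdeg1 hv1 hv12 hv1o.symm hv11.symm
      hv12'.symm hv1.symm hv1b.symm]
    -- the contracted instance
    set p₂ := Function.update (Function.update p (es 0) (p (es 0) * p (es 1))) (es 1) 0 with hp₂
    set ends'' := Function.update ends' (es 0) s(a₃, vs 2) with hends''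
    have hp₂0 : p₂ (es 0) = p (es 0) * p (es 1) := by
      rw [hp₂, Function.update_of_ne hff, Function.update_self]
    have hp₂1 : p₂ (es 1) = 0 := by rw [hp₂, Function.update_self]
    have hp₂e : ∀ e, e ≠ es 0 → e ≠ es 1 → p₂ e = p e := fun e h0 h1 => by
      rw [hp₂, Function.update_of_ne h1, Function.update_of_ne h0]
    have hends''0 : ends'' (es 0) = s(a₃, vs 2) := by rw [hends'', Function.update_self]
    have hends''e : ∀ e, e ≠ es 0 → ends'' e = ends' e := fun e h0 => by
      rw [hends'', Function.update_of_ne h0]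
    have hp₂p : IsProbVec p₂ :=
      (hp.update (es 0) (mul_nonneg (hp.nonneg _) (hp.nonneg _))
        (mul_le_one₀ (hp.le_one _) (hp.nonneg _) (hp.le_one _))).update (es 1) le_rfl zero_le_one
    -- the edges `es i`, `i ≥ 2`, are untouched
    have hes2 : ∀ i, 2 ≤ i → i < k → es i ≠ es 0 ∧ es i ≠ es 1 := fun i hi2 hik =>
      ⟨fun h => by have := hpath.es_inj hik (by omega) h; omega,
        fun h => by have := hpath.es_inj hik (by omega) h; omega⟩
    -- the shorter path
    set vs' : ℕ → V := fun i => if i = 0 then a₃ else vs (i + 1) with hvs'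
    set es' : ℕ → E := fun i => if i = 0 then es 0 else es (i + 1) with hes'
    have hvs'0 : vs' 0 = a₃ := by simp [hvs']
    have hvs'p : ∀ i, 0 < i → vs' i = vs (i + 1) := fun i hi => by
      simp [hvs', Nat.pos_iff_ne_zero.1 hi]
    have hes'0 : es' 0 = es 0 := by simp [hes']
    have hes'p : ∀ i, 0 < i → es' i = es (i + 1) := fun i hi => by
      simp [hes', Nat.pos_iff_ne_zero.1 hi]
    -- a nonzero edge of the contracted instance other than `es 0` is a nonzero edge of `p`, unmoved
    have hother : ∀ e, p₂ e ≠ 0 → e ≠ es 0 → p e ≠ 0 ∧ ends'' e = ends e := by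
      intro e he h0
      have h1 : e ≠ es 1 := fun h => he (by rw [h, hp₂1])
      rw [hp₂e e h0 h1] at he
      exact ⟨he, by rw [hends''e e h0, ← hagree e he]⟩
    have hpath' : IsPendantPath p₂ ends'' o a₁ a₂ a₃ b (k - 1) vs' es' := by
      refine ⟨by omega, hvs'0, ?_, ?_, ?_, ?_, ?_, ?_⟩
      · intro i hi
        rcases Nat.eq_zero_or_pos i with rfl | hi0
        · rw [hes'0, hends''0, hvs'0, hvs'p 1 Nat.one_pos]
        · rw [hes'p i hi0, hvs'p i hi0, hvs'p (i + 1) (by omega)]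
          obtain ⟨h0, h1⟩ := hes2 (i + 1) (by omega) (by omega)
          rw [hends''e _ h0, ← hagree _ (hpath.nz (i + 1) (by omega))]
          exact hpath.edge (i + 1) (by omega)
      · intro i hi
        rcases Nat.eq_zero_or_pos i with rfl | hi0
        · rw [hes'0, hp₂0]
          exact mul_ne_zero (hpath.nz 0 (by omega)) (hpath.nz 1 (by omega))
        · rw [hes'p i hi0]
          obtain ⟨h0, h1⟩ := hes2 (i + 1) (by omega) (by omega)
          rw [hp₂e _ h0 h1]
          exact hpath.nz (i + 1) (by omega)
      · intro i j hi hj hij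
        rcases Nat.eq_zero_or_pos i with rfl | hi0 <;> rcases Nat.eq_zero_or_pos j with rfl | hj0
        · rfl
        · rw [hvs'0, hvs'p j hj0, ← hvs0] at hij
          have := hpath.inj 0 (j + 1) (by omega) (by omega) hij
          omega
        · rw [hvs'0, hvs'p i hi0, ← hvs0] at hij
          have := hpath.inj (i + 1) 0 (by omega) (by omega) hij
          omega
        · rw [hvs'p i hi0, hvs'p j hj0] at hij
          have := hpath.inj (i + 1) (j + 1) (by omega) (by omega) hij
          omega
      · intro e he h3
        rw [hes'0]
        by_contra h0
        obtain ⟨hpe, hee⟩ := hother e he h0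
        rw [hee] at h3
        exact h0 (hpath.leaf e hpe h3)
      · intro i hi0 hik e he hv
        rw [hvs'p i hi0] at hv
        by_cases h0 : e = es 0
        · rw [h0, hends''0, Sym2.mem_iff] at hv
          rcases hv with hv | hv
          · rw [← hvs0] at hv
            have := hpath.inj (i + 1) 0 (by omega) (by omega) hv
            omega
          · have := hpath.inj (i + 1) 2 (by omega) hk2 hv
            have hi1 : i = 1 := by omega
            left
            rw [h0, hi1, Nat.sub_self, hes'0]
        · obtain ⟨hpe, hee⟩ := hother e he h0
          rw [hee] at hv
          rcases hpath.deg (i + 1) (by omega) (by omega) e hpe hv with h | h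
          · have hi2 : 2 ≤ i := by
              by_contra hlt
              have hi1 : i = 1 := by omega
              rw [hi1] at h
              exact he (by rw [h, hp₂1])
            left
            rw [hes'p (i - 1) (by omega), Nat.sub_add_cancel (by omega : 1 ≤ i)]
            simpa using h
          · right
            rw [hes'p i hi0]
            exact h
      · intro i hi0 hik
        rw [hvs'p i hi0]
        exact hpath.unmarked (i + 1) (by omega) (by omega)
    have hvs'k : vs' (k - 1) = vs k := by
      rw [hvs'p (k - 1) (by omega), Nat.sub_add_cancel (by omega : 1 ≤ k)]
    have hhub' : HubAt p₂ ends'' o a₁ a₂ a₃ b (vs' (k - 1)) (vs' (k - 1 - 1)) := by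
      intro e he hu
      rw [hvs'k] at hu ⊢
      by_cases h0 : e = es 0
      · -- the re-ended edge `{a₃, vs 2}` reaches `u` only for `k = 2`
        rw [h0, hends''0] at hu ⊢
        rw [Sym2.mem_iff] at hu
        rcases hu with hu | hu
        · rw [← hvs0] at hu
          have := hpath.inj k 0 le_rfl (by omega) hu
          omega
        · have hk2' : k = 2 := hpath.inj k 2 le_rfl hk2 hu
          left
          rw [hk2', hvs'0, ← hu, Sym2.eq_swap]
      · obtain ⟨hpe, hee⟩ := hother e he h0
        rw [hee] at hu ⊢
        rcases hhub e hpe hu with h | h | h | h | h | ⟨y, hey, hyu, hyo, hy1, hy2, hy3, hyb, hyleaf⟩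
        · -- the path edge into `u`
          by_cases hk3 : 3 ≤ k
          · left
            rw [h, hvs'p (k - 1 - 1) (by omega)]
            congr 2
            omega
          · exfalso
            have hk2' : k = 2 := by omega
            rw [hk2'] at h
            have h1 : vs 1 ∈ ends e := by rw [h]; exact Sym2.mem_mk_right _ _
            rcases hpath.deg 1 Nat.one_pos (by omega) e hpe h1 with h' | h'
            · exact h0 h'
            · exact he (by rw [h', hp₂1])
        · exact Or.inr (Or.inl h)
        · exact Or.inr (Or.inr (Or.inl h))
        · exact Or.inr (Or.inr (Or.inr (Or.inl h)))
        · exact Or.inr (Or.inr (Or.inr (Or.inr (Or.inl h))))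
        · refine Or.inr (Or.inr (Or.inr (Or.inr (Or.inr ⟨y, hey, hyu, hyo, hy1, hy2, hy3, hyb, ?_⟩))))
          intro e' he' hy'
          by_cases h0' : e' = es 0
          · exfalso
            rw [h0', hends''0, Sym2.mem_iff] at hy'
            rcases hy' with hy' | hy'
            · exact hy3 hy'
            · -- `y = vs 2`: the whisker would be an interior vertex or `u`
              by_cases hk3 : 3 ≤ k
              · have h1 : y ∈ ends (es 1) := by
                  rw [hpath.edge 1 (by omega), hy']; exact Sym2.mem_mk_right _ _
                have := hyleaf (es 1) (hpath.nz 1 (by omega)) h1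
                rw [← this, hpath.edge 1 (by omega), Sym2.eq_iff] at hey
                rcases hey with ⟨h1', _⟩ | ⟨_, h2'⟩
                · have := hpath.inj 1 k (by omega) le_rfl h1'
                  omega
                · have := hpath.inj 2 k hk2 le_rfl h2'
                  omega
              · have hk2' : k = 2 := by omega
                rw [hk2'] at hyu
                exact hyu hy'
          · obtain ⟨hpe', hee'⟩ := hother e' he' h0'
            rw [hee'] at hy'
            exact hyleaf e' hpe' hy'
    exact ih (k - 1) (by omega) p₂ ends'' vs' es' hp₂p hpath' (by rw [hvs'k]; exact hu1)
      (by rw [hvs'k]; exact hu2) (by rw [hvs'k]; exact huo) (by rw [hvs'k]; exact hub) hhub'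

/-- **(HCOV) at the end of a pendant path of any length** into a hub. -/
theorem HCov_pendant_path_any (o a₁ a₂ a₃ b : V) (h3o : a₃ ≠ o) (h31 : a₃ ≠ a₁) (h32 : a₃ ≠ a₂)
    (h3b : a₃ ≠ b) (k : ℕ) (p : E → R) (ends : E → Sym2 V) (vs : ℕ → V) (es : ℕ → E)
    (hp : IsProbVec p) (hpath : IsPendantPath p ends o a₁ a₂ a₃ b k vs es) (hu1 : vs k ≠ a₁)
    (hu2 : vs k ≠ a₂) (huo : vs k ≠ o) (hub : vs k ≠ b)
    (hhub : HubAt p ends o a₁ a₂ a₃ b (vs k) (vs (k - 1))) : HCov p ends o a₁ a₂ a₃ b :=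
  HCov_of_HMF p hp ends o a₁ a₂ a₃ b
    (HMF_pendant_path_any o a₁ a₂ a₃ b h3o h31 h32 h3b k p ends vs es hp hpath hu1 hu2 huo hub hhub)

end Main

end StarH

end Summit.Ventures.PercRepro2
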